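import Mathlib.InformationTheory.KullbackLeibler.Basic
import Mathlib.MeasureTheory.Measure.GiryMonad
import Literature.MathematicalPhysics.KineticTheory.InfiniteChainDynamics
import HarnessLib

/-!
# Invariant states of the infinite oscillator chain

Local observables, the Liouville operator, space and time invariance, regularity, Gibbs
mixtures and macro-ergodicity (Bernardin 2014, §1.1, Definition 1 and its footnote) for the
infinite deterministic pinned chain `P : OscillatorChain` on `ChainConfig = ℤ → ℝ × ℝ` (tree:
`OscillatorChain.force`, `OscillatorChain.IsChainGibbsMeasure` in `InfiniteChainDynamics`).

Topic `Literature/MathematicalPhysics/KineticTheory`; definition request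
`defn-InfiniteChainInvariantStates` (route `RegularOrRadiating` of `AtomisticToContinuum/FouriersLaw`
and its sibling routes `ParityLiouville`, `NoHiddenCharges`, `LocalOhmRigidity`, `LiouvilleLadder`,
`OpenChainMazur`, `AbelianSqueeze`).

## Provenance: a module split, no new mathematics

These definitions were first vendored (with the same bodies) inside the barrier entry
`Literature/Barriers/AtomisticToContinuum/MacroErgodicityHypothesis.lean`, next to the proved
obstruction `MacroErgodicityBarrier` and the OPEN named fact `MacroErgodicityHypothesis`. Routes
that need only the VOCABULARY (what a regular space-time invariant state of the infinite chain is)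
were importing the barrier file for it, and with it the open hypothesis and the Langevin-SDE cone
(`LangevinChainSDE` → Hörmander / Lyapunov / NESS facts) rode into their import cones. This module
is the fact-free home of the vocabulary: it imports only `InfiniteChainDynamics`, Mathlib's
Kullback–Leibler divergence and the Giry monad. The bodies below are those of the barrier file,
token for token (namespace-qualified names shortened inside their own namespace).

## Names (read before citing one)

* The eight chain-independent notions — `boxRestrict`, `IsLocalTestFunction`, `partialQZ`,
  `partialPZ`, `shift`, `IsShiftInvariant`, `boxRestrictAt`, `boxMarginal` — are declared here
  directory-aligned, `Literature.MathematicalPhysics.KineticTheory.HeatConduction.<name>`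
  (they were `Literature.Barriers.AtomisticToContinuum.HeatConduction.<name>`).
* The five chain-dependent notions and the two API lemmas — `liouvilleZ`, `IsTimeInvariant`,
  `IsRegular`, `IsGibbsMixture`, `IsMacroErgodic`, `IsGibbsMixture.of_isChainGibbsMeasure`,
  `isMacroErgodic_iff` — are declared here in the same namespace with the chain `P` as their first
  explicit argument: `liouvilleZ P f σ`, `IsTimeInvariant P ν`, `IsRegular P ν`,
  `IsGibbsMixture P ν`, `IsMacroErgodic P`. (The barrier file had hung them on the structure,
  `P.IsTimeInvariant ν` = `OscillatorChain.IsTimeInvariant P ν`; one fully-qualified name lives in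
  one module only, and those dot-notation names cannot leave the barrier file while gate-written
  theses files spell them, so the canonical bodies take the present names and the barrier file
  keeps every old name as a reducible alias of the declaration here — `P.IsTimeInvariant ν` and
  `IsTimeInvariant P ν` are then definitionally equal and interchangeable under `exact`.)

## Source (printed statements; Bernardin 2014, lecture notes, arXiv:1407.7023, §1.1)

"A probability measure `ν` is said to be `μ`-regular if for any finite box `Λ ⊂ ℤᵈ` … the
relative entropy of `ν|_Λ` w.r.t. `μ|_Λ` is bounded above by `C|Λ|` for a constant `C`
independent of `Λ`" (`μ` a Gibbs grand canonical ensemble; "`ν` is `μ`-regular is equivalent to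
`ν` is `μ'`-regular and we simply say that `ν` is regular"). **Definition 1 (Macro-Ergodicity).**
"We say that the dynamics generated by `𝒜` is macro-ergodic if and only if the only space-time
invariant regular measures `ν` for `𝒜` are mixtures (i.e. generalized convex combinations) of
Gibbs grand canonical ensembles." Footnote: "a probability measure `ν` is time invariant for the
infinite dynamics if and only if `∫ 𝒜f dν = 0` for any `f ∈ C₀¹(Ω̃)`." §1.1 (p. 3): "We also
introduce the sets `C₀ᵏ(X)`, `k ≥ 1` …, of bounded local functions on `X` which are
differentiable up to order `k` with bounded partial derivatives". The generator of the pinned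
chain is `𝒜 = ∑_x (p_x ∂_{q_x} + F_x ∂_{p_x})`, `F_x = -W'(q_x) + V'(q_{x+1} - q_x) - V'(q_x - q_{x-1})`
(Bernardin's `W` = the tree's pinning `U`). Macro-ergodicity is printed as a DEFINITION; the
source proves it only for dynamics perturbed by a conservative noise (its Thms 2–3, from
Fritz–Funaki–Lebowitz 1994) — for the deterministic anharmonic chain it is open (see the barrier
entry `Literature.Barriers.AtomisticToContinuum.MacroErgodicityHypothesis`), so there is no
`IsMacroErgodic`-asserting statement here.

## Design notes (carried over from the barrier entry)

* Time invariance is taken in the generator form of Bernardin's footnote (no infinite-volume flow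
  is needed) over the PRINTED test class `C₀¹` (bounded local `C¹` functions with bounded
  derivative), with integrability of `𝒜f` made an explicit conjunct (`𝒜f` grows like the force
  `F_x`, unbounded): the conjunct can only shrink the class of time-invariant `ν`, so
  `IsMacroErgodic` is formally at most WEAKER than Definition 1 read without it (for regular `ν`,
  which have the Gibbs exponential moments' first moments by the entropy inequality, the conjunct
  holds and nothing is lost). Coordinate derivatives are one-variable `deriv`s along coordinate
  lines as in `FouriersLaw.lean`; `𝒜f` is a `tsum` over `ℤ` of a finitely supported family for
  local `f`.
* Regularity is stated w.r.t. SOME Gibbs state at SOME temperature (Bernardin: independent of the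
  reference ensemble) on all finite boxes `{a, …, a+n}` of `ℤ` (`|Λ| = n+1`), with Mathlib's
  `InformationTheory.klDiv`; local test functions live on centred boxes `{-R, …, R}` (no loss:
  every box lies in a centred one).
* Mixtures: `ν = π.bind κ` for a probability `π` on temperatures and a measurable family `κ` of
  Gibbs states (`π`-a.e.), Mathlib's Giry monad.
* Only the pinned case (energy the sole conserved quantity, Gibbs states indexed by `T`) is
  formalised.
* NOT here (they stay in the barrier entry): the sector condition and its lemmas, the barrier
  `MacroErgodicityBarrier`, the open `MacroErgodicityHypothesis`, and the scope lemmas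
  `pinnedChain_outside_FFL_scope`, `pinnedChain_second_derivs_unbounded`.
-/

noncomputable section

open MeasureTheory Filter Topology Set InformationTheory
open scoped ENNReal

namespace Literature.MathematicalPhysics.KineticTheory.HeatConduction

/-! ### Local observables and the Liouville operator of the infinite chain -/

/-- Restriction of a configuration to the centred box `{-R, …, R}` (as a function on `Fin (2R+1)`,
site `i ↦ i - R`). [cite: Bernardin2014, §1.1] -/
def boxRestrict (R : ℕ) (σ : ChainConfig) : Fin (2 * R + 1) → ℝ × ℝ :=
  fun i => σ ((i : ℤ) - R)

/-- `f ∈ C₀¹(Ω̃)` is a local test function in Bernardin's sense: "bounded local functions …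
which are differentiable up to order `1` with bounded partial derivatives" — `f = g ∘ (restriction
to a finite box)` with `g` of class `C¹`, bounded, with bounded derivative.
[cite: Bernardin2014, §1.1 (definition of `C₀ᵏ(X)`) and Def. 1 footnote] -/
def IsLocalTestFunction (f : ChainConfig → ℝ) : Prop :=
  ∃ (R : ℕ) (g : (Fin (2 * R + 1) → ℝ × ℝ) → ℝ),
    ContDiff ℝ 1 g ∧ (∃ M : ℝ, ∀ y, |g y| ≤ M) ∧ (∃ M' : ℝ, ∀ y, ‖fderiv ℝ g y‖ ≤ M') ∧
      f = g ∘ boxRestrict R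

/-- Partial derivative along the position coordinate `q_x` of the infinite chain. [folklore] -/
def partialQZ (x : ℤ) (f : ChainConfig → ℝ) (σ : ChainConfig) : ℝ :=
  deriv (fun t => f (Function.update σ x (t, (σ x).2))) (σ x).1

/-- Partial derivative along the momentum coordinate `p_x` of the infinite chain. [folklore] -/
def partialPZ (x : ℤ) (f : ChainConfig → ℝ) (σ : ChainConfig) : ℝ :=
  deriv (fun t => f (Function.update σ x ((σ x).1, t))) (σ x).2

section OscillatorChain

variable (P : OscillatorChain)

/-- The Liouville operator of the infinite chain, `𝒜f = ∑_{x∈ℤ} (p_x ∂_{q_x} f + F_x ∂_{p_x} f)`,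
`F_x = -U'(q_x) + V'(q_{x+1} - q_x) - V'(q_x - q_{x-1})` (a finite sum for local `f`); the chain
`P` is the first explicit argument, `liouvilleZ P f σ`. [cite: Bernardin2014, §1.1] -/
def liouvilleZ (f : ChainConfig → ℝ) (σ : ChainConfig) : ℝ :=
  ∑' x : ℤ, ((σ x).2 * partialQZ x f σ + P.force σ x * partialPZ x f σ)

end OscillatorChain

/-- The spatial shift `(τσ)_x = σ_{x+1}`. [cite: Bernardin2014, §1.1] -/
def shift (σ : ChainConfig) : ChainConfig := fun x => σ (x + 1)

/-- `ν` is translation invariant. [cite: Bernardin2014, §1.1 Def. 1] -/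
def IsShiftInvariant (ν : Measure ChainConfig) : Prop :=
  ν.map shift = ν

section OscillatorChain

variable (P : OscillatorChain)

/-- `ν` is time invariant for the infinite dynamics of the chain `P` in the generator sense:
`∫ 𝒜f dν = 0` for every local test function `f ∈ C₀¹` — with `𝒜f` `ν`-integrable, made explicit
(the force `F_x` in `𝒜f` is unbounded). [cite: Bernardin2014, §1.1 Def. 1 footnote] -/
def IsTimeInvariant (ν : Measure ChainConfig) : Prop :=
  ∀ f : ChainConfig → ℝ, IsLocalTestFunction f →
    Integrable (liouvilleZ P f) ν ∧ ∫ σ, liouvilleZ P f σ ∂ν = 0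

end OscillatorChain

/-- Restriction of a configuration to the finite box (interval) `Λ = {a, a+1, …, a+n}` of `ℤ`.
[cite: Bernardin2014, §1.1] -/
def boxRestrictAt (a : ℤ) (n : ℕ) (σ : ChainConfig) : Fin (n + 1) → ℝ × ℝ :=
  fun i => σ (a + i)

/-- The marginal `ν|_Λ` of `ν` on the box `Λ = {a, …, a+n}` (`|Λ| = n + 1`). [cite: Bernardin2014, §1.1] -/
def boxMarginal (a : ℤ) (n : ℕ) (ν : Measure ChainConfig) : Measure (Fin (n + 1) → ℝ × ℝ) :=
  ν.map (boxRestrictAt a n)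

section OscillatorChain

variable (P : OscillatorChain)

/-- `ν` is REGULAR: relative to some Gibbs state `μ` of the chain `P` (at some temperature
`T > 0`), the relative entropy of the box marginals grows at most like the volume,
`H(ν|_Λ | μ|_Λ) ≤ C|Λ|` for every finite box `Λ = {a, …, a+n}` of `ℤ`, `C` independent of `Λ`.
[cite: Bernardin2014, §1.1] -/
def IsRegular (ν : Measure ChainConfig) : Prop :=
  ∃ (T : ℝ) (μ : Measure ChainConfig), 0 < T ∧ P.IsChainGibbsMeasure T μ ∧
    ∃ C : ℝ≥0∞, C ≠ ∞ ∧ ∀ (a : ℤ) (n : ℕ),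
      klDiv (boxMarginal a n ν) (boxMarginal a n μ) ≤ C * (n + 1)

/-- `ν` is a MIXTURE (generalized convex combination) of Gibbs grand canonical ensembles of the
pinned chain `P`: `ν = ∫ μ_T π(dT)` for a probability `π` on temperatures and a measurable family
`T ↦ μ_T` of Gibbs states. [cite: Bernardin2014, §1.1 Def. 1] -/
def IsGibbsMixture (ν : Measure ChainConfig) : Prop :=
  ∃ (π : Measure ℝ) (κ : ℝ → Measure ChainConfig), IsProbabilityMeasure π ∧ Measurable κ ∧
    (∀ᵐ T ∂π, 0 < T ∧ P.IsChainGibbsMeasure T (κ T)) ∧ ν = π.bind κ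

end OscillatorChain

/-- **Macro-ergodicity** (Bernardin 2014, Definition 1; name due to S. Goldstein) of the infinite
deterministic pinned chain `P`: the only space-time invariant regular probability measures are
mixtures of Gibbs grand canonical ensembles. This is a DEFINITION — a predicate on oscillator
chains, the chain `P` being an explicit argument — not an assertion: the source proves
macro-ergodicity only for dynamics perturbed by a conservative noise (Thms 2–3, from
Fritz–Funaki–Lebowitz 1994) and, for the deterministic chain, "To overcome our ignorance about
macro-ergodicity of the dynamics … we add a stochastic conserving perturbation" (§1.2); for the
conjunct's chains it is the OPEN `Literature.Barriers.AtomisticToContinuum.MacroErgodicityHypothesis`,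
so there is no `IsMacroErgodic`-asserting theorem to state. [cite: Bernardin2014, §1.1 Def. 1 and §1.2] -/
def IsMacroErgodic (P : OscillatorChain) : Prop :=
  ∀ ν : Measure ChainConfig, IsProbabilityMeasure ν → IsShiftInvariant ν → IsTimeInvariant P ν →
    IsRegular P ν → IsGibbsMixture P ν

/-! ### API -/

/-- Gibbs mixtures are closed under the trivial case: a Gibbs state is a mixture (Dirac mass on
its temperature). [folklore] -/
theorem IsGibbsMixture.of_isChainGibbsMeasure (P : OscillatorChain) {T : ℝ} (hT : 0 < T)
    {μ : Measure ChainConfig} (hμ : P.IsChainGibbsMeasure T μ) : IsGibbsMixture P μ := by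
  refine ⟨Measure.dirac T, fun _ => μ, inferInstance, measurable_const, ?_, ?_⟩
  · rw [MeasureTheory.ae_dirac_eq]
    exact Filter.eventually_pure.mpr ⟨hT, hμ⟩
  · rw [Measure.dirac_bind measurable_const]

/-- Unfolding macro-ergodicity. [cite: Bernardin2014, §1.1 Def. 1] -/
theorem isMacroErgodic_iff (P : OscillatorChain) :
    IsMacroErgodic P ↔ ∀ ν : Measure ChainConfig, IsProbabilityMeasure ν → IsShiftInvariant ν →
      IsTimeInvariant P ν → IsRegular P ν → IsGibbsMixture P ν :=
  Iff.rfl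

end Literature.MathematicalPhysics.KineticTheory.HeatConduction

end
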